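import Mathlib
import HarnessLib
import Summits.Parity.BatemanHorn.Theorems.IsogenyRedeiSplitBlockJacobiWeylDefs
import Summits.Parity.BatemanHorn.Theorems.IsogenyRedeiSplitBlockJacobiExpectedPart
import Summits.Parity.BatemanHorn.Theorems.IsogenyRedeiSplitBlockJacobiShellCount
import Summits.Parity.BatemanHorn.Theorems.IsogenyRedeiSplitBlockJacobiCell
import Summits.Parity.BatemanHorn.Theorems.IsogenyRedeiSplitBlockJacobiPoissonAsymptotics

/-!
# Route `IsogenyRedei`, crux `SplitBlockJacobiCorner` (stmt-Parity-15002), line `Sketch`: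
# the corner expected part is `o(x)` (`stub_cornerExpectedPart`)

The CORNER EXPECTED PART `E^c_{θ,μ}(x) = Σ_{(Q,Q′) ∈ P_θ(x), QQ′ ≤ x^{2−μ}} (Q|Q′) · 4x/(QQ′)`
(`P_θ(x) = pairs θ x`, the landed free pair set) is `o(x)` for `1/2 < θ`, `0 < μ < 2 − 2θ`.

Proof: rescale to the landed un-cut `stub_expectedPart`.  Put `α = (2 − μ)/2 ∈ (θ, 1)`,
`θ′ = θ/α ∈ (1/2, 1)`, `y = ⌊x^α⌋`.  Then `Σ_{q ∈ P_{θ′}(y)} (Q|Q′) · 4x/(QQ′) = (x/y) · E_{θ′}(y)`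
(`sum_scale`) is `≤ (x/y) · εy` eventually (along `y(x) → ∞`), and the index sets
`{q ∈ P_θ(x) : QQ′ ≤ x^{2α}}`, `P_{θ′}(y)` differ only inside the hyperbolic shell
`y² < QQ′ ≤ y² + 2y` (as `y² ≤ x^{2α} < (y+1)²`) and the row `Q = ⌊x^θ⌋` (as
`x^θ − 1 < y^{θ′} ≤ x^θ`); with `|(Q|Q′)| ≤ 1` (landed `Poisson.abs_jacobiSym_le_one`), the landed
shell estimate `Poisson.sum_shell_inv_le` and the harmonic bound these contribute
`≤ 8x · ((6 + 4 log y)/(y + 2) + (1 + log(y² + 1))/⌊x^θ⌋) = O(x log y / y^{θ′}) = o(x)`.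
No new definitions; everything is proved (no named facts).
-/

noncomputable section

open Finset Filter

namespace Summit.Parity.BatemanHorn.Cruxes.SplitBlockJacobiCorner.Sketch

open Summit.Parity.BatemanHorn.Cruxes.SplitBlockJacobi.CofactorRootDiscrepancy

/-- Pulling the factor `x/y` out of the rescaled expected sum:
`Σ_s (Q|Q′)·4x/(QQ′) = (x/y) · Σ_s (Q|Q′)·4y/(QQ′)` (`y > 0`). [folklore] -/
theorem sum_scale (s : Finset (ℕ × ℕ)) (x : ℕ) {y : ℕ} (hy : 0 < y) :
    ∑ q ∈ s, (jacobiSym (q.1 : ℤ) q.2 : ℝ) * (4 * (x : ℝ) / ((q.1 * q.2 : ℕ) : ℝ)) =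
      (x : ℝ) / y *
        ∑ q ∈ s, (jacobiSym (q.1 : ℤ) q.2 : ℝ) * (4 * (y : ℝ) / ((q.1 * q.2 : ℕ) : ℝ)) := by
  rw [mul_sum]
  refine sum_congr rfl fun q _ => ?_
  have hy0 : (y : ℝ) ≠ 0 := by positivity
  have e : (x : ℝ) / y * y = x := div_mul_cancel₀ _ hy0
  calc (jacobiSym (q.1 : ℤ) q.2 : ℝ) * (4 * (x : ℝ) / ((q.1 * q.2 : ℕ) : ℝ))
      = (jacobiSym (q.1 : ℤ) q.2 : ℝ) * (4 * ((x : ℝ) / y * y) / ((q.1 * q.2 : ℕ) : ℝ)) := by rw [e]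
    _ = _ := by ring

/-- **Cut pairs not in the rescaled pair set lie in the shell.**  If `y^{θ′} ≤ x^θ` and
`x^{2−μ} < (y+1)²`, every `q ∈ {q ∈ P_θ(x) : QQ′ ≤ x^{2−μ}} ∖ P_{θ′}(y)` has `1 ≤ Q ≤ y` and
`y² < QQ′ ≤ y² + 2y`. [folklore] -/
theorem mem_shell_of_mem_sdiff {θ θ' μ : ℝ} {x y : ℕ} (h1 : (y : ℝ) ^ θ' ≤ (x : ℝ) ^ θ)
    (h4 : (x : ℝ) ^ (2 - μ) < (((y + 1) ^ 2 : ℕ) : ℝ)) {q : ℕ × ℕ}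
    (hq : q ∈ (pairs θ x).filter (fun q : ℕ × ℕ => ((q.1 * q.2 : ℕ) : ℝ) ≤ (x : ℝ) ^ (2 - μ)) \
      pairs θ' y) :
    1 ≤ q.1 ∧ q.1 ≤ y ∧ y ^ 2 < q.1 * q.2 ∧ q.1 * q.2 ≤ y ^ 2 + 2 * y := by
  unfold pairs at hq
  simp only [Finset.mem_sdiff, Finset.mem_filter, Finset.mem_product, Finset.mem_range] at hq
  obtain ⟨⟨⟨-, hp1, hp2, hm1, hm2, hθQ, hlt, -⟩, hcut⟩, hnB⟩ := hq
  have hlt2 : q.1 * q.2 < (y + 1) ^ 2 := by exact_mod_cast hcut.trans_lt h4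
  have hsq : (y + 1) ^ 2 = y ^ 2 + 2 * y + 1 := by ring
  have hQ1 : 1 ≤ q.1 := hp1.one_le
  have hQ'1 : 1 ≤ q.2 := hp2.one_le
  have hQy : q.1 ≤ y := by
    by_contra h
    push Not at h
    have h' : (y + 1) * (y + 1) ≤ q.1 * q.2 := Nat.mul_le_mul (by omega) (by omega)
    rw [hsq] at hlt2
    nlinarith
  have hyQ : y ^ 2 < q.1 * q.2 := by
    by_contra h
    push Not at h
    apply hnB
    refine ⟨⟨?_, ?_⟩, hp1, hp2, hm1, hm2, h1.trans_lt hθQ, hlt, by omega⟩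
    · have : q.1 ≤ q.1 * q.2 := Nat.le_mul_of_pos_right _ (by omega)
      omega
    · have : q.2 ≤ q.1 * q.2 := Nat.le_mul_of_pos_left _ (by omega)
      omega
  exact ⟨hQ1, hQy, hyQ, by omega⟩

/-- **Rescaled pairs not in the cut pair set lie in the shell or in one row.**  If `y ≤ x`,
`1 ≤ y`, `x^θ − 1 < y^{θ′}` and `y² ≤ x^{2−μ}`, every
`q ∈ P_{θ′}(y) ∖ {q ∈ P_θ(x) : QQ′ ≤ x^{2−μ}}` either has `1 ≤ Q ≤ y`, `y² < QQ′ ≤ y² + 2y`, or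
has `Q = ⌊x^θ⌋` and `1 ≤ Q′ ≤ y² + 1`. [folklore] -/
theorem mem_shell_or_row_of_mem_sdiff {θ θ' μ : ℝ} {x y : ℕ} (hyx : y ≤ x) (hy : 1 ≤ y)
    (h2 : (x : ℝ) ^ θ - 1 < (y : ℝ) ^ θ') (h3 : ((y ^ 2 : ℕ) : ℝ) ≤ (x : ℝ) ^ (2 - μ))
    {q : ℕ × ℕ}
    (hq : q ∈ pairs θ' y \
      (pairs θ x).filter (fun q : ℕ × ℕ => ((q.1 * q.2 : ℕ) : ℝ) ≤ (x : ℝ) ^ (2 - μ))) :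
    (1 ≤ q.1 ∧ q.1 ≤ y ∧ y ^ 2 < q.1 * q.2 ∧ q.1 * q.2 ≤ y ^ 2 + 2 * y) ∨
      (q.1 = ⌊(x : ℝ) ^ θ⌋₊ ∧ 1 ≤ q.2 ∧ q.2 ≤ y ^ 2 + 1) := by
  unfold pairs at hq
  simp only [Finset.mem_sdiff, Finset.mem_filter, Finset.mem_product, Finset.mem_range] at hq
  obtain ⟨⟨-, hp1, hp2, hm1, hm2, hθQ, hlt, hprod⟩, hnA⟩ := hq
  have hQ1 : 1 ≤ q.1 := hp1.one_le
  have hQ'1 : 1 ≤ q.2 := hp2.one_le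
  have hQ'le : q.2 ≤ y ^ 2 + 1 := le_trans (Nat.le_mul_of_pos_left _ (by omega)) hprod
  have hQle : q.1 ≤ y ^ 2 + 1 := le_trans (Nat.le_mul_of_pos_right _ (by omega)) hprod
  have hyx2 : y ^ 2 ≤ x ^ 2 := Nat.pow_le_pow_left hyx 2
  by_cases hxQ : (x : ℝ) ^ θ < (q.1 : ℝ)
  · left
    have hcut : ¬ ((q.1 * q.2 : ℕ) : ℝ) ≤ (x : ℝ) ^ (2 - μ) := by
      intro hcut
      apply hnA
      exact ⟨⟨⟨by omega, by omega⟩, hp1, hp2, hm1, hm2, hxQ, hlt, by omega⟩, hcut⟩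
    push Not at hcut
    have hyQ : y ^ 2 < q.1 * q.2 := by exact_mod_cast h3.trans_lt hcut
    have hQy : q.1 ≤ y := by
      by_contra h
      push Not at h
      have h' : (y + 1) * (y + 1) ≤ q.1 * q.2 := Nat.mul_le_mul (by omega) (by omega)
      nlinarith
    exact ⟨hQ1, hQy, hyQ, by omega⟩
  · right
    push Not at hxQ
    refine ⟨?_, hQ'1, hQ'le⟩
    have hlo : (x : ℝ) ^ θ - 1 < q.1 := h2.trans hθQ
    have hθ0 : 0 ≤ (x : ℝ) ^ θ := Real.rpow_nonneg (Nat.cast_nonneg _) θ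
    have hle : q.1 ≤ ⌊(x : ℝ) ^ θ⌋₊ := Nat.le_floor hxQ
    have hlt' : ⌊(x : ℝ) ^ θ⌋₊ < q.1 + 1 := (Nat.floor_lt hθ0).mpr (by push_cast; linarith)
    omega

/-- **Shell + row estimate.**  For `y ≥ 2`, `Q₀ ≥ 1` and any finite set `P` of pairs each of
which lies in the shell `1 ≤ Q ≤ y`, `y² < QQ′ ≤ y² + 2y` or in the row `Q = Q₀`,
`1 ≤ Q′ ≤ y² + 1`:
`Σ_P |(Q|Q′) · 4x/(QQ′)| ≤ 4x · ((4(1 + log y) + 2)/(y + 2) + (1 + log(y² + 1))/Q₀)`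
(landed `Poisson.sum_shell_inv_le` with `X = y(y+2)`, `δ′ = 2/(y+2)`, and the harmonic bound
`Poisson.sum_Icc_inv_le_log`). [folklore] -/
theorem sum_shell_row_le (x : ℕ) {y : ℕ} (hy : 2 ≤ y) {Q₀ : ℕ} (hQ₀ : 0 < Q₀)
    (P : Finset (ℕ × ℕ))
    (hP : ∀ q ∈ P, (1 ≤ q.1 ∧ q.1 ≤ y ∧ y ^ 2 < q.1 * q.2 ∧ q.1 * q.2 ≤ y ^ 2 + 2 * y) ∨
      (q.1 = Q₀ ∧ 1 ≤ q.2 ∧ q.2 ≤ y ^ 2 + 1)) :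
    ∑ q ∈ P, |(jacobiSym (q.1 : ℤ) q.2 : ℝ) * (4 * (x : ℝ) / ((q.1 * q.2 : ℕ) : ℝ))| ≤
      4 * (x : ℝ) * ((4 * (1 + Real.log y) + 2) / ((y : ℝ) + 2) +
        (1 + Real.log ((y ^ 2 + 1 : ℕ) : ℝ)) / (Q₀ : ℝ)) := by
  -- each term is at most `4x · 1/(QQ′)`
  have hterm : ∀ q ∈ P, |(jacobiSym (q.1 : ℤ) q.2 : ℝ) * (4 * (x : ℝ) / ((q.1 * q.2 : ℕ) : ℝ))| ≤
      4 * (x : ℝ) * (1 / ((q.1 * q.2 : ℕ) : ℝ)) := by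
    intro q _
    have hnn : 0 ≤ 4 * (x : ℝ) / ((q.1 * q.2 : ℕ) : ℝ) := by positivity
    rw [abs_mul, abs_of_nonneg hnn, mul_one_div]
    exact mul_le_of_le_one_left hnn (Poisson.abs_jacobiSym_le_one q.1 q.2)
  refine (sum_le_sum hterm).trans ?_
  rw [← mul_sum]
  refine mul_le_mul_of_nonneg_left ?_ (by positivity)
  rw [← sum_filter_add_sum_filter_not P (fun q : ℕ × ℕ =>
    1 ≤ q.1 ∧ q.1 ≤ y ∧ y ^ 2 < q.1 * q.2 ∧ q.1 * q.2 ≤ y ^ 2 + 2 * y)]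
  have hy0 : (0 : ℝ) < y := by exact_mod_cast (lt_of_lt_of_le (by norm_num) hy)
  have hy2 : (2 : ℝ) ≤ y := by exact_mod_cast hy
  refine add_le_add ?_ ?_
  · -- the shell, via the landed `Poisson.sum_shell_inv_le`
    have hX : (0 : ℝ) < (y : ℝ) * ((y : ℝ) + 2) := by positivity
    have hδ0 : (0 : ℝ) ≤ 2 / ((y : ℝ) + 2) := by positivity
    have hδ2 : 2 / ((y : ℝ) + 2) ≤ 1 / 2 := by
      rw [div_le_div_iff₀ (by positivity) (by norm_num)]
      linarith
    have h := Poisson.sum_shell_inv_le y (by omega) hX hδ0 hδ2 (P.filter (fun q : ℕ × ℕ =>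
        1 ≤ q.1 ∧ q.1 ≤ y ∧ y ^ 2 < q.1 * q.2 ∧ q.1 * q.2 ≤ y ^ 2 + 2 * y)) (by
      intro q hq
      rw [mem_filter] at hq
      obtain ⟨-, hq1, hq2, hq3, hq4⟩ := hq
      refine ⟨hq1, hq2, ?_, ?_⟩
      · rw [show (y : ℝ) * ((y : ℝ) + 2) * (1 - 2 / ((y : ℝ) + 2)) = ((y ^ 2 : ℕ) : ℝ) by
          push_cast; field_simp; ring]
        exact_mod_cast hq3
      · rw [show (y : ℝ) * ((y : ℝ) + 2) = ((y ^ 2 + 2 * y : ℕ) : ℝ) by push_cast; ring]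
        exact_mod_cast hq4)
    refine h.trans (le_of_eq ?_)
    have hy0' : (y : ℝ) ≠ 0 := hy0.ne'
    field_simp
    ring
  · -- the row `Q = Q₀`
    have hsub : P.filter (fun q : ℕ × ℕ =>
        ¬ (1 ≤ q.1 ∧ q.1 ≤ y ∧ y ^ 2 < q.1 * q.2 ∧ q.1 * q.2 ≤ y ^ 2 + 2 * y)) ⊆
        ({Q₀} : Finset ℕ) ×ˢ Finset.Icc 1 (y ^ 2 + 1) := by
      intro q hq
      rw [mem_filter] at hq
      rcases hP q hq.1 with h | ⟨h1, h2, h3⟩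
      · exact absurd h hq.2
      · rw [mem_product, mem_singleton, mem_Icc]
        exact ⟨h1, h2, h3⟩
    have hQ₀0 : (0 : ℝ) < Q₀ := by exact_mod_cast hQ₀
    calc ∑ q ∈ P.filter (fun q : ℕ × ℕ =>
            ¬ (1 ≤ q.1 ∧ q.1 ≤ y ∧ y ^ 2 < q.1 * q.2 ∧ q.1 * q.2 ≤ y ^ 2 + 2 * y)),
            (1 : ℝ) / ((q.1 * q.2 : ℕ) : ℝ)
        ≤ ∑ q ∈ ({Q₀} : Finset ℕ) ×ˢ Finset.Icc 1 (y ^ 2 + 1), (1 : ℝ) / ((q.1 * q.2 : ℕ) : ℝ) :=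
          sum_le_sum_of_subset_of_nonneg hsub (fun _ _ _ => by positivity)
      _ = ∑ Q' ∈ Finset.Icc 1 (y ^ 2 + 1), (1 : ℝ) / ((Q₀ * Q' : ℕ) : ℝ) := by
          rw [sum_product, sum_singleton]
      _ = (1 / (Q₀ : ℝ)) * ∑ Q' ∈ Finset.Icc (1 : ℕ) (y ^ 2 + 1), (1 : ℝ) / (Q' : ℝ) := by
          rw [mul_sum]
          refine sum_congr rfl fun Q' _ => ?_
          push_cast
          rw [one_div_mul_one_div]
      _ ≤ (1 / (Q₀ : ℝ)) * (1 + Real.log ((y ^ 2 + 1 : ℕ) : ℝ)) :=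
          mul_le_mul_of_nonneg_left (Poisson.sum_Icc_inv_le_log _) (by positivity)
      _ = (1 + Real.log ((y ^ 2 + 1 : ℕ) : ℝ)) / (Q₀ : ℝ) := by
          rw [one_div_mul_eq_div]

/-- **The cut corner sum minus the rescaled un-cut sum is small.**  Under the comparison
inequalities `y^{θ′} ≤ x^θ < y^{θ′} + 1`, `y² ≤ x^{2−μ} < (y+1)²` (`2 ≤ y ≤ x`, `⌊x^θ⌋ ≥ 1`):
`|Σ_{q ∈ P_θ(x), QQ′ ≤ x^{2−μ}} (Q|Q′)·4x/(QQ′) − Σ_{q ∈ P_{θ′}(y)} (Q|Q′)·4x/(QQ′)|`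
`≤ 8x · ((4(1 + log y) + 2)/(y + 2) + (1 + log(y² + 1))/⌊x^θ⌋)`. [folklore] -/
theorem abs_sub_rescaled_le {θ θ' μ : ℝ} {x y : ℕ} (hy : 2 ≤ y) (hyx : y ≤ x)
    (h1 : (y : ℝ) ^ θ' ≤ (x : ℝ) ^ θ) (h2 : (x : ℝ) ^ θ - 1 < (y : ℝ) ^ θ')
    (h3 : ((y ^ 2 : ℕ) : ℝ) ≤ (x : ℝ) ^ (2 - μ)) (h4 : (x : ℝ) ^ (2 - μ) < (((y + 1) ^ 2 : ℕ) : ℝ))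
    (hQ₀ : 0 < ⌊(x : ℝ) ^ θ⌋₊) :
    |∑ q ∈ (pairs θ x).filter (fun q : ℕ × ℕ => ((q.1 * q.2 : ℕ) : ℝ) ≤ (x : ℝ) ^ (2 - μ)),
          (jacobiSym (q.1 : ℤ) q.2 : ℝ) * (4 * (x : ℝ) / ((q.1 * q.2 : ℕ) : ℝ)) -
        ∑ q ∈ pairs θ' y, (jacobiSym (q.1 : ℤ) q.2 : ℝ) * (4 * (x : ℝ) / ((q.1 * q.2 : ℕ) : ℝ))| ≤
      8 * (x : ℝ) * ((4 * (1 + Real.log y) + 2) / ((y : ℝ) + 2) +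
        (1 + Real.log ((y ^ 2 + 1 : ℕ) : ℝ)) / (⌊(x : ℝ) ^ θ⌋₊ : ℝ)) := by
  rw [← sum_sdiff_sub_sum_sdiff]
  have hAB := sum_shell_row_le x hy hQ₀
    ((pairs θ x).filter (fun q : ℕ × ℕ => ((q.1 * q.2 : ℕ) : ℝ) ≤ (x : ℝ) ^ (2 - μ)) \ pairs θ' y)
    (fun q hq => Or.inl (mem_shell_of_mem_sdiff h1 h4 hq))
  have hBA := sum_shell_row_le x hy hQ₀
    (pairs θ' y \ (pairs θ x).filter (fun q : ℕ × ℕ => ((q.1 * q.2 : ℕ) : ℝ) ≤ (x : ℝ) ^ (2 - μ)))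
    (fun q hq => mem_shell_or_row_of_mem_sdiff hyx (by omega) h2 h3 hq)
  refine (abs_sub _ _).trans ?_
  refine (add_le_add (abs_sum_le_sum_abs _ _) (abs_sum_le_sum_abs _ _)).trans ?_
  refine (add_le_add hAB hBA).trans_eq ?_
  ring

/-- **Comparison of the two scales.**  With `α θ′ = θ`, `2α = 2 − μ`, `0 < α ≤ 1`,
`0 < θ′ ≤ 1`, `x ≥ 1` and `y ≤ x^α < y + 1` (i.e. `y = ⌊x^α⌋`):
`y^{θ′} ≤ x^θ < y^{θ′} + 1` (subadditivity of `t ↦ t^{θ′}`), `y² ≤ x^{2−μ} < (y+1)²`, `y ≤ x`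
and `⌊x^θ⌋ ≥ 1`. [folklore] -/
theorem rescale_compare {α θ θ' μ : ℝ} {x y : ℕ} (hα0 : 0 < α) (hα1 : α ≤ 1) (hθ'0 : 0 < θ')
    (hθ'1 : θ' ≤ 1) (hαθ' : α * θ' = θ) (hα2 : α * ((2 : ℕ) : ℝ) = 2 - μ) (hθ0 : 0 ≤ θ)
    (hx1 : 1 ≤ x) (hyle : (y : ℝ) ≤ (x : ℝ) ^ α) (hylt : (x : ℝ) ^ α < (y : ℝ) + 1) :
    (y : ℝ) ^ θ' ≤ (x : ℝ) ^ θ ∧ (x : ℝ) ^ θ - 1 < (y : ℝ) ^ θ' ∧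
      ((y ^ 2 : ℕ) : ℝ) ≤ (x : ℝ) ^ (2 - μ) ∧ (x : ℝ) ^ (2 - μ) < (((y + 1) ^ 2 : ℕ) : ℝ) ∧
      y ≤ x ∧ 0 < ⌊(x : ℝ) ^ θ⌋₊ := by
  have hx0 : (0 : ℝ) ≤ x := Nat.cast_nonneg x
  have hx1' : (1 : ℝ) ≤ x := by exact_mod_cast hx1
  have hxα0 : 0 ≤ (x : ℝ) ^ α := Real.rpow_nonneg hx0 α
  have hxα1 : 1 ≤ (x : ℝ) ^ α := Real.one_le_rpow hx1' hα0.le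
  have hy0 : (0 : ℝ) ≤ y := Nat.cast_nonneg y
  have hxθ : (x : ℝ) ^ θ = ((x : ℝ) ^ α) ^ θ' := by rw [← Real.rpow_mul hx0, hαθ']
  have hx2 : (x : ℝ) ^ (2 - μ) = ((x : ℝ) ^ α) ^ 2 := by rw [← hα2, Real.rpow_mul_natCast hx0]
  refine ⟨?_, ?_, ?_, ?_, ?_, Nat.floor_pos.mpr (Real.one_le_rpow hx1' hθ0)⟩
  · rw [hxθ]
    exact Real.rpow_le_rpow hy0 hyle hθ'0.le
  · have ha : 0 ≤ (x : ℝ) ^ α - 1 := by linarith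
    have hsub : ((x : ℝ) ^ α) ^ θ' ≤ ((x : ℝ) ^ α - 1) ^ θ' + 1 := by
      have h := Real.rpow_add_le_add_rpow ha zero_le_one hθ'0.le hθ'1
      rwa [sub_add_cancel, Real.one_rpow] at h
    have hlt : ((x : ℝ) ^ α - 1) ^ θ' < (y : ℝ) ^ θ' := Real.rpow_lt_rpow ha (by linarith) hθ'0
    rw [hxθ]
    linarith
  · rw [hx2, Nat.cast_pow]
    exact pow_le_pow_left₀ hy0 hyle 2
  · rw [hx2, Nat.cast_pow, Nat.cast_add_one]
    exact pow_lt_pow_left₀ hylt hxα0 two_ne_zero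
  · have h := Real.rpow_le_rpow_of_exponent_le hx1' hα1
    rw [Real.rpow_one] at h
    exact_mod_cast hyle.trans h

/-- **Smallness of the shell and row terms.**  If `log y ≤ y^{θ′/2}`, `320/ε ≤ y^{θ′/2}`,
`1 ≤ y^{θ′/2}`, `y ≥ 1`, `θ′ ≤ 1` and `y^{θ′} ≤ 2Q`, `Q > 0`, then
`(4(1 + log y) + 2)/(y + 2) + (1 + log(y² + 1))/Q ≤ ε/16`
(both terms are `≤ (6 + 4 log y)/y^{θ′} ≤ ε/32`). [folklore] -/
theorem shell_row_small {ε θ' Q : ℝ} {y : ℕ} (hε : 0 < ε) (hθ'1 : θ' ≤ 1) (hy1 : 1 ≤ (y : ℝ))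
    (hlog : Real.log y ≤ (y : ℝ) ^ (θ' / 2)) (h320 : 320 / ε ≤ (y : ℝ) ^ (θ' / 2))
    (hv1 : 1 ≤ (y : ℝ) ^ (θ' / 2)) (hQ : 0 < Q) (hQge : (y : ℝ) ^ θ' ≤ 2 * Q) :
    (4 * (1 + Real.log y) + 2) / ((y : ℝ) + 2) + (1 + Real.log ((y ^ 2 + 1 : ℕ) : ℝ)) / Q ≤
      ε / 16 := by
  have hypos' : (0 : ℝ) < y := by linarith
  have hlog0 : 0 ≤ Real.log y := Real.log_nonneg hy1
  have hyθ'pos : 0 < (y : ℝ) ^ θ' := Real.rpow_pos_of_pos hypos' θ'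
  -- the key smallness `6 + 4 log y ≤ (ε/32) y^θ'`
  have hvv : (y : ℝ) ^ (θ' / 2) * (y : ℝ) ^ (θ' / 2) = (y : ℝ) ^ θ' := by
    rw [← Real.rpow_add hypos', add_halves]
  have hkey : 6 + 4 * Real.log y ≤ ε / 32 * (y : ℝ) ^ θ' := by
    have h10 : 6 + 4 * Real.log y ≤ 10 * (y : ℝ) ^ (θ' / 2) := by linarith
    have h320' : 320 ≤ ε * (y : ℝ) ^ (θ' / 2) := by rwa [div_le_iff₀' hε] at h320
    have hmul : 320 * (y : ℝ) ^ (θ' / 2) ≤ ε * (y : ℝ) ^ (θ' / 2) * (y : ℝ) ^ (θ' / 2) :=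
      mul_le_mul_of_nonneg_right h320' (by linarith)
    rw [← hvv]
    linarith
  -- the shell term
  have hyθ'le : (y : ℝ) ^ θ' ≤ (y : ℝ) + 2 := by
    have h := Real.rpow_le_rpow_of_exponent_le hy1 hθ'1
    rw [Real.rpow_one] at h
    linarith
  have hR1 : (4 * (1 + Real.log y) + 2) / ((y : ℝ) + 2) ≤ (6 + 4 * Real.log y) / (y : ℝ) ^ θ' := by
    rw [show 4 * (1 + Real.log y) + 2 = 6 + 4 * Real.log y by ring]
    exact div_le_div_of_nonneg_left (by linarith) hyθ'pos hyθ'le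
  -- the row term
  have hlog2 : Real.log ((y ^ 2 + 1 : ℕ) : ℝ) ≤ 1 + 2 * Real.log y := by
    have hle : ((y ^ 2 + 1 : ℕ) : ℝ) ≤ 2 * (y : ℝ) ^ 2 := by push_cast; nlinarith
    calc Real.log ((y ^ 2 + 1 : ℕ) : ℝ) ≤ Real.log (2 * (y : ℝ) ^ 2) :=
          Real.log_le_log (by positivity) hle
      _ = Real.log 2 + 2 * Real.log y := by
          rw [Real.log_mul (by norm_num) (by positivity), Real.log_pow]
          push_cast
          ring
      _ ≤ 1 + 2 * Real.log y := by linarith [Real.log_two_lt_d9]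
  have hR2 : (1 + Real.log ((y ^ 2 + 1 : ℕ) : ℝ)) / Q ≤ (4 + 4 * Real.log y) / (y : ℝ) ^ θ' := by
    rw [div_le_div_iff₀ hQ hyθ'pos]
    have hl0 : 0 ≤ 2 + 2 * Real.log y := by linarith
    calc (1 + Real.log ((y ^ 2 + 1 : ℕ) : ℝ)) * (y : ℝ) ^ θ'
        ≤ (2 + 2 * Real.log y) * (2 * Q) := mul_le_mul (by linarith) hQge hyθ'pos.le hl0
      _ = (4 + 4 * Real.log y) * Q := by ring
  have hsum : (6 + 4 * Real.log y) / (y : ℝ) ^ θ' + (4 + 4 * Real.log y) / (y : ℝ) ^ θ' ≤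
      ε / 16 := by
    rw [← add_div, div_le_iff₀ hyθ'pos]
    linarith
  linarith

/-- **`stub_cornerExpectedPart`** of the line skeleton `Sketch` (crux
`IsogenyRedei.SplitBlockJacobiCorner`, stmt-Parity-15002): the CORNER EXPECTED PART
`E^c_{θ,μ}(x) = Σ_{(Q,Q′) ∈ P_θ(x), QQ′ ≤ x^{2−μ}} (Q|Q′) · 4x/(QQ′)` is `o(x)` for `1/2 < θ`,
`0 < μ < 2 − 2θ`: for every `ε > 0`, eventually `|E^c_{θ,μ}(x)| ≤ εx`.  Rescaling
(`y = ⌊x^{(2−μ)/2}⌋`, `θ′ = 2θ/(2−μ) ∈ (1/2, 1)`) to the landed `stub_expectedPart θ′` at `y`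
(`sum_scale`), the two index sets differing by a hyperbolic shell and one row
(`abs_sub_rescaled_le`), both `O(x log y / y^{θ′})` (`shell_row_small`). [folklore] -/
theorem stub_cornerExpectedPart :
    ∀ θ μ : ℝ, 1 / 2 < θ → 0 < μ → μ < 2 - 2 * θ → ∀ ε : ℝ, 0 < ε → ∀ᶠ x : ℕ in atTop,
      |∑ q ∈ (pairs θ x).filter (fun q : ℕ × ℕ => ((q.1 * q.2 : ℕ) : ℝ) ≤ (x : ℝ) ^ (2 - μ)),
          (jacobiSym (q.1 : ℤ) q.2 : ℝ) * (4 * (x : ℝ) / ((q.1 * q.2 : ℕ) : ℝ))| ≤ ε * x := by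
  intro θ μ hθ hμ hμθ ε hε
  -- the exponents `α = (2 - μ)/2 ∈ (θ, 1)` and `θ' = θ/α ∈ (1/2, 1)`
  obtain ⟨α, hαdef⟩ : ∃ α : ℝ, α = (2 - μ) / 2 := ⟨_, rfl⟩
  have hθα : θ < α := by rw [hαdef]; linarith
  have hα1 : α < 1 := by rw [hαdef]; linarith
  have hα0 : 0 < α := by linarith
  have hα2 : α * ((2 : ℕ) : ℝ) = 2 - μ := by rw [hαdef]; push_cast; ring
  obtain ⟨θ', hθ'def⟩ : ∃ θ' : ℝ, θ' = θ / α := ⟨_, rfl⟩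
  have hθ'1 : θ' < 1 := by rw [hθ'def]; exact (div_lt_one hα0).mpr hθα
  have hθ'h : 1 / 2 < θ' := by rw [hθ'def, lt_div_iff₀ hα0]; linarith
  have hθ'0 : 0 < θ' := by linarith
  have hαθ' : α * θ' = θ := by rw [hθ'def]; field_simp
  -- Step 1: the landed un-cut expected part at exponent `θ'` and the smallness conditions, in `y`
  have hE : ∀ᶠ y : ℕ in atTop, |∑ q ∈ pairs θ' y,
      (jacobiSym (q.1 : ℤ) q.2 : ℝ) * (4 * (y : ℝ) / ((q.1 * q.2 : ℕ) : ℝ))| ≤ ε / 4 * y :=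
    stub_expectedPart θ' hθ'h hθ'1 (ε / 4) (by positivity)
  have hY : ∀ᶠ y : ℕ in atTop, |∑ q ∈ pairs θ' y,
      (jacobiSym (q.1 : ℤ) q.2 : ℝ) * (4 * (y : ℝ) / ((q.1 * q.2 : ℕ) : ℝ))| ≤ ε / 4 * y ∧
      Real.log y ≤ (y : ℝ) ^ (θ' / 2) ∧ 320 / ε ≤ (y : ℝ) ^ (θ' / 2) ∧ 1 ≤ (y : ℝ) ^ (θ' / 2) ∧
      2 ≤ (y : ℝ) ^ θ' ∧ 2 ≤ y := by
    filter_upwards [hE, Poisson.eventually_log_le_rpow (θ' / 2) (by positivity),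
      Poisson.eventually_le_rpow (θ' / 2) (320 / ε) (by positivity),
      Poisson.eventually_le_rpow (θ' / 2) 1 (by positivity), Poisson.eventually_le_rpow θ' 2 hθ'0,
      eventually_ge_atTop 2] with y h1 h2 h3 h4 h5 h6
    exact ⟨h1, h2, h3, h4, h5, h6⟩
  -- Step 2: pull back along `y(x) = ⌊x^α⌋ → ∞`
  have hT : Tendsto (fun x : ℕ => ⌊(x : ℝ) ^ α⌋₊) atTop atTop :=
    tendsto_nat_floor_atTop.comp ((tendsto_rpow_atTop hα0).comp tendsto_natCast_atTop_atTop)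
  filter_upwards [hT.eventually hY, eventually_ge_atTop 1] with x hx hx1
  obtain ⟨hEy, hlog, h320, hv1, hyθ2, hy2⟩ := hx
  -- Step 3: comparison inequalities between `x` and `y = ⌊x^α⌋`
  obtain ⟨y, hydef⟩ : ∃ y : ℕ, y = ⌊(x : ℝ) ^ α⌋₊ := ⟨_, rfl⟩
  rw [← hydef] at hEy hlog h320 hv1 hyθ2 hy2
  have hxα0 : 0 ≤ (x : ℝ) ^ α := Real.rpow_nonneg (Nat.cast_nonneg x) α
  have hyle : (y : ℝ) ≤ (x : ℝ) ^ α := by rw [hydef]; exact Nat.floor_le hxα0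
  have hylt : (x : ℝ) ^ α < (y : ℝ) + 1 := by rw [hydef]; exact Nat.lt_floor_add_one _
  obtain ⟨h1, h2, h3, h4, hyx, hQ₀pos⟩ :=
    rescale_compare hα0 hα1.le hθ'0 hθ'1.le hαθ' hα2 (by linarith) hx1 hyle hylt
  have hypos : 0 < y := by omega
  have hy1 : (1 : ℝ) ≤ y := by exact_mod_cast hypos
  have hQ₀ge : (y : ℝ) ^ θ' ≤ 2 * (⌊(x : ℝ) ^ θ⌋₊ : ℝ) := by
    have h := Nat.lt_floor_add_one ((x : ℝ) ^ θ)
    linarith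
  -- Step 4: the three estimates
  have hB : |∑ q ∈ pairs θ' y,
      (jacobiSym (q.1 : ℤ) q.2 : ℝ) * (4 * (x : ℝ) / ((q.1 * q.2 : ℕ) : ℝ))| ≤ ε / 4 * x := by
    rw [sum_scale _ x hypos, abs_mul, abs_of_nonneg (by positivity : (0 : ℝ) ≤ (x : ℝ) / y)]
    calc (x : ℝ) / y * |∑ q ∈ pairs θ' y,
          (jacobiSym (q.1 : ℤ) q.2 : ℝ) * (4 * (y : ℝ) / ((q.1 * q.2 : ℕ) : ℝ))|
        ≤ (x : ℝ) / y * (ε / 4 * y) := mul_le_mul_of_nonneg_left hEy (by positivity)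
      _ = ε / 4 * x := by field_simp
  have hD := abs_sub_rescaled_le hy2 hyx h1 h2 h3 h4 hQ₀pos
  have hR := shell_row_small hε hθ'1.le hy1 hlog h320 hv1 (by exact_mod_cast hQ₀pos) hQ₀ge
  -- Step 5: assemble
  have hxR := mul_le_mul_of_nonneg_left hR (by positivity : (0 : ℝ) ≤ 8 * (x : ℝ))
  have hεx : 0 ≤ ε * x := by positivity
  set SA := ∑ q ∈ (pairs θ x).filter (fun q : ℕ × ℕ => ((q.1 * q.2 : ℕ) : ℝ) ≤ (x : ℝ) ^ (2 - μ)),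
    (jacobiSym (q.1 : ℤ) q.2 : ℝ) * (4 * (x : ℝ) / ((q.1 * q.2 : ℕ) : ℝ)) with hSA
  set SB := ∑ q ∈ pairs θ' y,
    (jacobiSym (q.1 : ℤ) q.2 : ℝ) * (4 * (x : ℝ) / ((q.1 * q.2 : ℕ) : ℝ)) with hSB
  calc |SA| = |SB + (SA - SB)| := by rw [add_sub_cancel]
    _ ≤ |SB| + |SA - SB| := abs_add_le _ _
    _ ≤ ε / 4 * x + 8 * (x : ℝ) * (ε / 16) := add_le_add hB (hD.trans hxR)
    _ ≤ ε * x := by linarith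

end Summit.Parity.BatemanHorn.Cruxes.SplitBlockJacobiCorner.Sketch

end
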